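/-
Copyright (c) 2026 the pub-hodgecm-mathlib formalisation cell (harness21).  Typer seat hodgecm-mathlib-typ-T5a (g0), topic T5 = P8
«(C♯)hol interior», 2026-08-31.  Statement-only Literature module: TWO named facts (the two halves of one printed lemma), no proof.
-/
import Literature.NumberTheory.Automorphic.Liu2021.ThetaLiftFromLineMeets
import Literature.NumberTheory.Automorphic.ConjugateSelfDualInfinityType
import HarnessLib

/-!
# [Liu2021, App. D Lem. D.2 (le:weil_arch), clause (2) at the indefinite place and clause (1) at the definite places, as applied in the proof of
# Prop. 4.13 Case 1 (l. 2137–2141); Konno–Konno 2007 Thm. 5.4; Bergeron–Millson–Moeglin 2016 §5.7] — THE RAW ARCHIMEDEAN TABLE of a holomorphic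
# `H¹`-cohomological theta lift from the line `⟨a⟩` at the `μ`-splitting: `(m_ι, sign Im ι(e)) = (−1, −)` at `ι`, `(m, sign) ∈ {(−1,−), (1,+)}` elsewhere
# (sub-nodes C∞ and Cc of node C = D2 of the (C♯)hol interior)

Topic `NumberTheory/Automorphic/Liu2021`; namespace `Literature.NumberTheory.Automorphic.Liu2021`.  STATEMENT-ONLY: TWO closed named facts
`def meetsThetaLiftFromLine_hol_archTypeAt : Prop` (C∞ = Lem. D.2 (2) applied at the place of `ι`) and `def meetsThetaLiftFromLine_hol_archTypeAway : Prop`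
(Cc = Lem. D.2 (1) applied at the complex places `≠` that of `ι`); no `sorry`, no instance, no notation; imports = tree (★ `ThetaLiftFromLineMeets`,
★ `ConjugateSelfDualInfinityType` for `IsConjugateSymplectic.infinityType` ∕ `exponentAt`).  Cell hodgecm-mathlib FLOOR 0, programme P2, topic T5 = P8:
these two facts + the CM-type ARITHMETIC (seat T5b's `StubRawArchTableWeightOne ∕ …Admissible`, payable: ★ `cmTypeOf = {φ ∣ exponentAt < 0}`,
★ `hasWeight_of_hasInfinityType`, ★ `isAdmissibleElement_iff`) RETIRE node C ★ `meetsThetaLiftFromLine_hol_hasWeightOne_admissible` (p826167); they are stated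
in the RAW per-embedding currency `(exponentAt hμ.infinityType τ′, sign (τ′ e).im)` — Liu's `(m_i, sign of i⁻¹τ_i⁺(e))` — so that the arithmetic is a separate,
payable step.  Frame = (C♯)hol's VERBATIM + letter A's adelic transport `ιA`.

PRINT.  [Liu2021, proof of Prop. 4.13 Case 1, FJcycle.tex l. 2137–2141; Camb. J. Math. 9 (2021) p. 48]: «… we suppose that `Φ_F = {τ₁ = τ, τ₂, …, τ_d}` and
`Φ = {τ₁⁺, …, τ_d⁺}` with `π(τ_i⁺) = τ_i`.  Using `Φ`, we obtain an isomorphism `G_ℝ ≃ U(n−1,1)_ℝ × U(n,0)_ℝ × ⋯ × U(n,0)_ℝ`, and accordingly a decomposition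
`π_∞ = ⊗_{i=1}^d π_{∞i}`.  Under the notation from Subsection D.1, we have `π_{∞1} ≃ ω_{n−1,1}^{m₁,±,1}` and `π_{∞i} ≃ ω_{n,0}^{m_i,±,1}` for `i ≥ 2`, where
`(m₁, …, m_d)` is the weight of `μ` and the sign in the parameter is the sign of `i⁻¹τ_i⁺(e)`.  By Lemma D.2, we know that `μ` is of weight one and `ε_e` is
`μ`-admissible.»  **Lemma D.2** (l. 5279–5289; p. 127): «(1) Among the representations `ω_{n,0}^{m,±,l}`, only `ω_{n,0}^{1,+,0}` and `ω_{n,0}^{−1,−,0}` are the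
trivial character.  (2) If `n ≥ 3`, then in the set `{ω_{n−1,1}^{m,±,l}}`, only `ω_{n−1,1}^{−1,−,0}` (resp. `ω_{n−1,1}^{1,+,0}`) is isomorphic to `π^{1,0}_{n−1,1}`
(resp. `π^{0,1}_{n−1,1}`).»  With App. D §D.1 (l. 5268–5271): «`μ_m(z) = arg(z)^m`, `m` odd integer; `ε = ±i`; `χ_l(z) = z^l`», and §4.1 (l. 1908–1912):
«`μ_τ : z ↦ arg(z)^{−w_τ}` … via the unique element `τ′ ∈ Φ_μ` above `τ`».  Proof of Lem. D.2 (l. 5291–5295): «The explicit formulae for the `K_{p,q}`-type of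
`ω_{p,q}^{m,±,l}` can be found in [KK07]*Theorem 5.4 with `p′+q′ = 1` … Comparing the formula for the highest weights in [BMM]*5.7 … with [KK07]*Theorem 5.4,
we obtain the assertions.»

DICTIONARY (print ↔ tree, nothing re-declared).  Liu's `m_i` read through the embedding `τ_i⁺` is the tree's `exponentAt hμ.infinityType τ_i⁺` (★
`IdeleClassGroup.exponentAt`: `μ_w(u) = (ι_w u/|ι_w u|)^{e_w}` read through `φ` over `w` is `e_w` or `−e_w`; [Liu2021, Rem. 4.2 ∕ Def. 4.3] docstring there:
«in Liu's notation the exponent in the coordinate `τ′ ∈ Φ_μ` is `−w_τ`»); `e ∈ E^{−×}` is the lane's `a·δ′ = algebraMap a * (2·imagUnit L)⁻¹` (as in (C♯)hol), so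
`τ(e)` is purely imaginary and «the sign of `i⁻¹τ(e)`» is the sign of `(τ e).im`.  At the place of `ι` (Liu's `τ₁⁺ = ι ∈ Φ ∋ τ′`), «`π_{∞1} ≅ π^{1,0}`» is
(C♯)hol's ★ `IsHolCotangentAt (cmArchSection L ι H T hT) …`, and Lem. D.2 (2) reads `(m₁, ±) = (−1, −)`: `exponentAt hμ.infinityType ι = −1 ∧ (ι e).im < 0`.
At a place `w ≠ w(ι)` the cotangent form is right-invariant under `K_c ⊇ U(H)(L⁺_w) ≅ U(3,0)_ℝ` (★ `cmCompactFactor`), so «`π_{∞i}` is the trivial character»,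
and Lem. D.2 (1) reads `(m_i, ±) ∈ {(1,+), (−1,−)}` — a conjugation-stable condition, hence stated for EVERY embedding `τ′` over `w`.  (Liu's third parameter
`l` — the archimedean component of the `U(W)`-character — is not visible on the seam's continuous weight `f`; «`χ_∞ = 1`» lives in node B.)  The implicit input
«`π_∞` of a global theta lift from the compact `U(W)(ℝ) = U(1)^d` is the `⊗_i ω(μ_{w_i}, e, ·)`-isotypic archimedean module» is the archimedean localisation
of a theta lift ([Rallis1984, proof of Thm. 1.2.2 p. 356]; [Howe1989, Rem. (b)]); in the tree the `(𝔤, K)`-module of `P` at `ι` is ★ `DiscreteAutomorphicRep.archModule`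
and the archimedean Weil datum of the junction `U(2,1) × U(1)` is ★ `KonnoKonno2007.RealUnitaryDualPair` ∕ `IsArchWeilDatum` (degree-one `K × K′`-types ★
`JunctionDegreeOneKTypes`); their junction is the L-sized part of a pay-down of C∞.

HONEST SCOPE.  (i) C∞ is the irreducible archimedean content of (C♯)hol (which oscillator `(𝔤,K)`-module of `U(2,1)` carries the holomorphic class); Cc is a
vacuum-character check for the compact pair `U(3,0) × U(1)` ([KashiwaraVergne1978]; ★ `Adams2007.VacuumWeight`).  (ii) Junk models: as for node C (without
`IsHolCotangentAt`, antiholomorphic `P` gives `(+1, +)` at `ι`; without `MeetsThetaLiftFromLine` at THIS `(μ, a)` the table is about an unrelated pair).  (iii) The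
two facts and T5b's arithmetic imply node C (kernel composition in the T5 Lines draft v2); nothing finite-adelic is concluded.  HC_CM is proved only modulo the
printed citations until rung 0 closes; filing this file books TWO printed statements (the two clauses of Lem. D.2 as applied), against which node C retires.

## References
* [Liu2021] Y. Liu, Camb. J. Math. 9 (2021) = arXiv:2102.11518: proof of Prop. 4.13 Case 1 (l. 2137–2141, p. 48); §4.1 (l. 1908–1912), Rem. 4.2, Def. 4.3;
  App. D §D.1 (l. 5268–5277), Lem. D.2 (l. 5279–5295, p. 127).
* [KonnoKonno2007] T. Konno, K. Konno, Kyushu J. Math. 61 (2007), Thm. 5.4.  [BergeronMillsonMoeglin2016Balls] Acta Math. 216 (2016), §5.7.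
* [Rallis1984] S. Rallis, Compositio Math. 51 (1984), proof of Thm. 1.2.2 p. 356.  [Howe1989] R. Howe, J. AMS 2 (1989), Thm. 1, Rem. (b) p. 536.
* [KashiwaraVergne1978] M. Kashiwara, M. Vergne, Invent. Math. 44 (1978), (5.1)–(5.5).
-/

noncomputable section

open NumberField NumberField.InfinitePlace MeasureTheory IsDedekindDomain
open scoped Matrix ComplexOrder

namespace Literature.NumberTheory.Automorphic.Liu2021

open _root_.MeasureTheory
open Literature.NumberTheory.Automorphic Literature.NumberTheory.Automorphic.UnitaryGroup
open Literature.NumberTheory.Automorphic.UnitaryGroup.CotangentForms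
open Literature.NumberTheory.Automorphic.IdeleClassGroup
open Literature.NumberTheory.GelbartRogawski1991.UnitaryDualPair

/-- **C∞ — [Liu2021, Lem. D.2 (2)] applied at the place of `ι` (proof of Prop. 4.13 Case 1, l. 2137–2141): «only `ω_{n−1,1}^{−1,−,0}` is isomorphic to
`π^{1,0}_{n−1,1}`»** [KonnoKonno2007 Thm. 5.4; BergeronMillsonMoeglin2016 §5.7]: in the frame of (C♯)hol with letter A's adelic transport `ιA`, if the discrete
`P` of `U(H)(𝔸_{L⁺})` contains a non-zero theta vector from the line `⟨a⟩` at the `μ`-attached splitting (★ `MeetsThetaLiftFromLine … P μ hμ a ιA`) and is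
`H¹`-cohomological of HOLOMORPHIC type at `ι` (★ `IsHolCotangentAt`), then the raw archimedean parameters at `ι` are `(m_ι, sign) = (−1, −)`:
`exponentAt hμ.infinityType ι = −1` and `Im ι(a·δ′) < 0`.
[cite: Liu2021, App. D Lem. D.2 (2) p. 127 (l. 5285); Prop. 4.13 proof Case 1 (l. 2137–2141, p. 48); Rem. 4.2 / Def. 4.3]
[cite: KonnoKonno2007, Thm. 5.4] [cite: BergeronMillsonMoeglin2016Balls, §5.7] [cite: Rallis1984, Thm. 1.2.2 proof p. 356] -/
def meetsThetaLiftFromLine_hol_archTypeAt : Prop :=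
  ∀ (L : Type) [Field L] [NumberField L] [IsCMField L] (ι : L →+* ℂ) (H : Matrix (Fin 3) (Fin 3) L) (T : GL (Fin 3) ℂ)
    (hT : (T : Matrix (Fin 3) (Fin 3) ℂ)ᴴ * H.map ι * (T : Matrix (Fin 3) (Fin 3) ℂ) = Literature.Geometry.ComplexHyperbolic.BallModel.J),
    (∀ τ' : L →+* ℂ, InfinitePlace.mk τ' ≠ InfinitePlace.mk ι → (H.map τ').PosDef) → 2 ≤ Module.finrank ℚ ↥(maximalRealSubfield L) →
    ∀ {n' : ℕ} (e₁ : Fin 3 × Fin 1 ≃ Fin n') (dV : Fin 3 → L) (hdV : ∀ i, IsCMField.complexConj L (dV i) = dV i)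
      (hdV0 : ∀ i, dV i ≠ 0) (g : GL (Fin 3) L),
      ((g : Matrix (Fin 3) (Fin 3) L).map (cmConjRingHom L))ᵀ * H * (g : Matrix (Fin 3) (Fin 3) L) = Matrix.diagonal dV →
    ∀ (ιA : (adelicGroupData (↥(maximalRealSubfield L)) L (IsCMField.complexConj L) 3 H).Adelic →*
        ↥(UnitaryGroup.adelic (↥(maximalRealSubfield L)) L (IsCMField.complexConj L) 3 (Matrix.diagonal dV))),
      (∀ k, ((ιA k : ↥(UnitaryGroup.adelic (↥(maximalRealSubfield L)) L (IsCMField.complexConj L) 3 (Matrix.diagonal dV))) :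
            GL (Fin 3) (AdeleRing (𝓞 L) L)) =
          (toAdeleGL L g)⁻¹ * adelicVal (↥(maximalRealSubfield L)) L (IsCMField.complexConj L) 3 H k * toAdeleGL L g) →
    ∀ [CompactSpace (↥(UnitaryGroup.adelic (↥(maximalRealSubfield L)) L (IsCMField.complexConj L) 3 (Matrix.diagonal dV)) ⧸
        (UnitaryGroup.toAdelic (↥(maximalRealSubfield L)) L (IsCMField.complexConj L) 3 (Matrix.diagonal dV)).range)],
    ∀ (μA : Measure (adelicGroupData (↥(maximalRealSubfield L)) L (IsCMField.complexConj L) 3 H).automorphicQuotient)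
      [(adelicGroupData (↥(maximalRealSubfield L)) L (IsCMField.complexConj L) 3 H).IsAutomorphicMeasure μA],
      ∀ (P : DiscreteAutomorphicRep (adelicGroupData (↥(maximalRealSubfield L)) L (IsCMField.complexConj L) 3 H) μA)
        (μ : Literature.NumberTheory.Automorphic.IdeleClassGroup L →ₜ* Circle) (hμ : IsConjugateSymplectic L μ)
        (a : (↥(maximalRealSubfield L))ˣ),
        MeetsThetaLiftFromLine L 3 H e₁ dV hdV hdV0 P μ hμ a ιA →
        P.IsHolCotangentAt (cmArchSection L ι H T hT) (cmCompactFactor L ι H T hT) →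
          exponentAt hμ.infinityType ι = -1 ∧
            (ι (algebraMap (↥(maximalRealSubfield L)) L a * (2 * imagUnit L)⁻¹)).im < 0

/-- **Cc — [Liu2021, Lem. D.2 (1)] applied at the complex places `≠` that of `ι` (proof of Prop. 4.13 Case 1, l. 2137–2141): «among the representations
`ω_{n,0}^{m,±,l}`, only `ω_{n,0}^{1,+,0}` and `ω_{n,0}^{−1,−,0}` are the trivial character»** [KonnoKonno2007 Thm. 5.4; KashiwaraVergne1978]: in the same frame,
if `P` contains a non-zero theta vector from `⟨a⟩` at the `μ`-splitting and is `H¹`-cohomological holomorphic at `ι` RELATIVE TO THE COMPACT FACTOR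
`K_c = cmCompactFactor …` (so `P_w` is trivial at every complex place `w ≠ w(ι)`), then at every embedding `τ′` off the place of `ι` the raw parameters are
`(m, sign) ∈ {(−1, −), (1, +)}`: `(exponentAt hμ.infinityType τ′ = −1 ∧ Im τ′(a·δ′) < 0) ∨ (exponentAt hμ.infinityType τ′ = 1 ∧ 0 < Im τ′(a·δ′))`.
[cite: Liu2021, App. D Lem. D.2 (1) p. 127 (l. 5283); Prop. 4.13 proof Case 1 (l. 2137–2141, p. 48); Rem. 4.2 / Def. 4.3]
[cite: KonnoKonno2007, Thm. 5.4] [cite: KashiwaraVergne1978, (5.1)–(5.5)] [cite: Rallis1984, Thm. 1.2.2 proof p. 356] -/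
def meetsThetaLiftFromLine_hol_archTypeAway : Prop :=
  ∀ (L : Type) [Field L] [NumberField L] [IsCMField L] (ι : L →+* ℂ) (H : Matrix (Fin 3) (Fin 3) L) (T : GL (Fin 3) ℂ)
    (hT : (T : Matrix (Fin 3) (Fin 3) ℂ)ᴴ * H.map ι * (T : Matrix (Fin 3) (Fin 3) ℂ) = Literature.Geometry.ComplexHyperbolic.BallModel.J),
    (∀ τ' : L →+* ℂ, InfinitePlace.mk τ' ≠ InfinitePlace.mk ι → (H.map τ').PosDef) → 2 ≤ Module.finrank ℚ ↥(maximalRealSubfield L) →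
    ∀ {n' : ℕ} (e₁ : Fin 3 × Fin 1 ≃ Fin n') (dV : Fin 3 → L) (hdV : ∀ i, IsCMField.complexConj L (dV i) = dV i)
      (hdV0 : ∀ i, dV i ≠ 0) (g : GL (Fin 3) L),
      ((g : Matrix (Fin 3) (Fin 3) L).map (cmConjRingHom L))ᵀ * H * (g : Matrix (Fin 3) (Fin 3) L) = Matrix.diagonal dV →
    ∀ (ιA : (adelicGroupData (↥(maximalRealSubfield L)) L (IsCMField.complexConj L) 3 H).Adelic →*
        ↥(UnitaryGroup.adelic (↥(maximalRealSubfield L)) L (IsCMField.complexConj L) 3 (Matrix.diagonal dV))),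
      (∀ k, ((ιA k : ↥(UnitaryGroup.adelic (↥(maximalRealSubfield L)) L (IsCMField.complexConj L) 3 (Matrix.diagonal dV))) :
            GL (Fin 3) (AdeleRing (𝓞 L) L)) =
          (toAdeleGL L g)⁻¹ * adelicVal (↥(maximalRealSubfield L)) L (IsCMField.complexConj L) 3 H k * toAdeleGL L g) →
    ∀ [CompactSpace (↥(UnitaryGroup.adelic (↥(maximalRealSubfield L)) L (IsCMField.complexConj L) 3 (Matrix.diagonal dV)) ⧸
        (UnitaryGroup.toAdelic (↥(maximalRealSubfield L)) L (IsCMField.complexConj L) 3 (Matrix.diagonal dV)).range)],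
    ∀ (μA : Measure (adelicGroupData (↥(maximalRealSubfield L)) L (IsCMField.complexConj L) 3 H).automorphicQuotient)
      [(adelicGroupData (↥(maximalRealSubfield L)) L (IsCMField.complexConj L) 3 H).IsAutomorphicMeasure μA],
      ∀ (P : DiscreteAutomorphicRep (adelicGroupData (↥(maximalRealSubfield L)) L (IsCMField.complexConj L) 3 H) μA)
        (μ : Literature.NumberTheory.Automorphic.IdeleClassGroup L →ₜ* Circle) (hμ : IsConjugateSymplectic L μ)
        (a : (↥(maximalRealSubfield L))ˣ),
        MeetsThetaLiftFromLine L 3 H e₁ dV hdV hdV0 P μ hμ a ιA →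
        P.IsHolCotangentAt (cmArchSection L ι H T hT) (cmCompactFactor L ι H T hT) →
          ∀ τ' : L →+* ℂ, InfinitePlace.mk τ' ≠ InfinitePlace.mk ι →
            (exponentAt hμ.infinityType τ' = -1 ∧ (τ' (algebraMap (↥(maximalRealSubfield L)) L a * (2 * imagUnit L)⁻¹)).im < 0) ∨
              (exponentAt hμ.infinityType τ' = 1 ∧ 0 < (τ' (algebraMap (↥(maximalRealSubfield L)) L a * (2 * imagUnit L)⁻¹)).im)

end Literature.NumberTheory.Automorphic.Liu2021

end
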